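import Summits.BirchSwinnertonDyer.BirchSwinnertonDyer.Theorems.GenusKolyvaginAtTwoVisiblePairAtTwoInjective
import Summits.BirchSwinnertonDyer.BirchSwinnertonDyer.Theorems.GenusKolyvaginAtTwoEquivariantKolyvaginExactAtTwoSelmerConditionVisible
import HarnessLib

/-!
# Route `GenusKolyvaginAtTwo`, LINE 6, KEY crux Q3 (inner statement of stmt-BirchSwinnertonDyer-22137):
# the VISIBILITY input `hvis` of the deepening step IS the habitat condition (H2) — both cases
# (helper, PROVED; seat `bsd-line-gk2-p2` g11)

`…VisiblePairAtTwoShallowExactness` (this seat, p644336) displays, among the level-`2` data of the shallow certificate,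
the visibility of the embedded pair `{ι u, ι y₀}` at level `2^M` (`hvis`), and proves it from `Input.sel_visible`
= (H2) when the auxiliary class `u` is Selmer (`hvis_of_sel_visible`). Here the OTHER case: `u` Selmer off `ℓ₀` but
RAMIFIED at `ℓ₀` (the case `Sel^{(2)}(E/ℚ) = 0`). Then a relation `rK₁ (a₁ ι u) + rK₂ (a₂ ι y₀) = 0` forces
`a₁ ι u` to be Selmer at `ℓ₀` (the Selmer conditions at the odd good prime `ℓ₀ ∤ d_K` of BOTH members factor through
the pairing with the inertia groups above `ℓ₀` inside `Γ_{K(E_K[2^M])}` — seat gk2-p3's `…SelmerConditionVisible`),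
hence `a₁ ι u = 0` (`2u = 0`, and `ι (a₁ u)` Selmer at `ℓ₀` iff `a₁ u` is — `torsionH1OfDvd_mem_selmerLocalKer_iff`);
then (H2) kills `a₂ ι y₀`.

* `torsionH1OfDvd_mem_selmerLocalKer_iff` — **`u ∈ selmerLocalKer_E(d) ⟺ ι u ∈ selmerLocalKer_E(n)`** for `d ∣ n`,
  any curve over any field, any `K`-field `E` (both kernels of `H¹(K, E[·]) → H¹(E, E)` along the same pair);
* `mem_loc₁_of_rK_add_eq_zero` — at an odd good prime `ℓ₀ ∤ d_K` (level `2^N` arbitrary): `rK₁ s + rK₂ t = 0` and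
  `t ∈ loc₂ (pl ℓ₀)` imply `s ∈ loc₁ (pl ℓ₀)`;
* `hvis_of_sel_visible_of_not_mem` — `hvis` from (H2) when `u ∉ loc₁ W 1 (pl ℓ₀)`, `u` Selmer off `ℓ₀`, `y₀` Selmer.

Helper (`--supports` 22137), closes nothing; THEOREMS ONLY, 0 sorry, standard axioms. BSD is not proved by this;
(H2) stays a hypothesis.

References: [McCallumLMS1991] p. 299, §4 Lemma 4.3, §5 proof of Prop. 5.2 ((7)–(8)); [GrossLMS1991] §7 (7.1),
(7.4), Prop. 9.1; [SerreGaloisCohomology1997] I §2.4.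
-/

set_option autoImplicit false
set_option linter.dupNamespace false -- tree convention: `Summit.BirchSwinnertonDyer.BirchSwinnertonDyer.Theorems` (summit = sub-problem)

noncomputable section

open scoped Classical

universe u

namespace Summit.BirchSwinnertonDyer.BirchSwinnertonDyer.Theorems.GenusExact.VisiblePairAtTwo

open WeierstrassCurve NumberField IsDedekindDomain Field Finset Rat.HeightOneSpectrum
open Literature.NumberTheory.EllipticCurves Literature.NumberTheory.GaloisRepresentations
open Literature.NumberTheory.EllipticCurves.KolyvaginDescent
open Summit.BirchSwinnertonDyer.BirchSwinnertonDyer.Theorems.GenusExact.SelmerDescent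

/-! ## §1 `ι` and the Selmer local conditions: `u` Selmer at `E` iff `ι u` is -/

section Generic

variable {K : Type u} [Field K] (W : WeierstrassCurve K) (E : Type u) [Field E] [Algebra K E]

/-- **`u ∈ selmerLocalKer_E(d) ⟺ ι u ∈ selmerLocalKer_E(n)`** (`d ∣ n`): both are the kernels of
`H¹(K, E[·]) → H¹(E, E(K̄_E))`, and `E[d] ↪ E[n] → E(K̄_E)` is `E[d] → E(K̄_E)` (functoriality in compatible
pairs). [cite: SerreGaloisCohomology1997, I §2.4] [cite: SilvermanAEC2009, X.§4] -/
theorem torsionH1OfDvd_mem_selmerLocalKer_iff {d n : ℤ} (h : d ∣ n) (u : galH1Torsion W d) :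
    u ∈ selmerLocalKer W E d ↔ torsionH1OfDvd W h u ∈ selmerLocalKer W E n := by
  have hfac := map_one_eq_comp_of_eq (ContinuousMonoidHom.id (absoluteGaloisGroup K))
    (AddSubgroup.inclusion (geomTorsion_le_of_dvd W h)) (fun _ _ ↦ rfl)
    (resGal (K := K) E) ((pointsMap W E).comp (geomTorsion W n).subtype)
    (fun σ P ↦ by
      simp only [AddMonoidHom.coe_comp, AddSubgroup.coe_subtype, Function.comp_apply,
        Literature.NumberTheory.EllipticCurves.AddSubgroup.torsionBy.coe_smul]
      exact pointsMap_smul W E σ P)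
    (Φ := resGal (K := K) E) (Ψ := (pointsMap W E).comp (geomTorsion W d).subtype)
    (fun σ P ↦ by
      simp only [AddMonoidHom.coe_comp, AddSubgroup.coe_subtype, Function.comp_apply,
        Literature.NumberTheory.EllipticCurves.AddSubgroup.torsionBy.coe_smul]
      exact pointsMap_smul W E σ P)
    rfl (by ext P; rfl)
  have happ := congrArg (fun f ↦ (TopModuleCat.Hom.hom f) u) hfac
  simp only [TopModuleCat.hom_comp, ContinuousLinearMap.comp_apply] at happ
  change _ = 0 ↔ _ = 0
  simp only [LinearMap.toAddMonoidHom_coe, ContinuousLinearMap.coe_coe]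
  change (ContinuousCohomology.map (resGal (K := K) E)
      (resHomOfEquivariant _ ((pointsMap W E).comp (geomTorsion W d).subtype) _) 1).hom u = 0 ↔
    (ContinuousCohomology.map (resGal (K := K) E)
      (resHomOfEquivariant _ ((pointsMap W E).comp (geomTorsion W n).subtype) _) 1).hom
      ((ContinuousCohomology.map (ContinuousMonoidHom.id (absoluteGaloisGroup K))
        (resHomOfEquivariant _ (AddSubgroup.inclusion (geomTorsion_le_of_dvd W h)) (fun _ _ ↦ rfl))
          1).hom u) = 0
  rw [happ]

end Generic

/-! ## §2 The Selmer condition at the shallow prime from a relation in `HK` -/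

section Instance

variable (W : WeierstrassCurve ℚ) [W.IsElliptic] [W.IsGloballyMinimal] (K : Type) [Field K] [NumberField K]
  (N : ℕ) {θ : K} (hθ : θ ∉ Set.range (algebraMap ℚ K))
  (hθsq : θ ^ 2 = algebraMap ℚ K ((NumberField.discr K : ℤ) : ℚ))

omit [W.IsGloballyMinimal] in
/-- **A relation `rK₁ s + rK₂ t = 0` with `t` Selmer at `ℓ₀` forces `s` Selmer at `ℓ₀`**, at an odd prime `ℓ₀ ∤ d_K`
of good reduction for `E` and `E^{(d_K)}` (level `2^N`): both Selmer conditions at `ℓ₀` are "pairs to `0` with the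
inertia groups above `ℓ₀`" inside `Γ_{K(E_K[2^N])}` (`…SelmerConditionVisible`), and the relation makes the two
pairings opposite. [cite: McCallumLMS1991, p. 299 and §4 Lemma 4.3] [cite: GrossLMS1991, §7 (7.1), (7.4)] -/
theorem mem_loc₁_of_rK_add_eq_zero (hK : IsImaginaryQuadratic K) [(twin W K).IsElliptic] {ℓ₀ : ℕ}
    [Fact ℓ₀.Prime] (hℓ₀2 : ℓ₀ ≠ 2) (hℓ₀d : ¬ ((ℓ₀ : ℤ) ∣ NumberField.discr K))
    (hgood : W.HasGoodReductionAtPrime ℓ₀) (hgood' : (twin W K).HasGoodReductionAtPrime ℓ₀)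
    {s : galH1Torsion W (lvl N)} {t : galH1Torsion (twin W K) (lvl N)}
    (hrel : rK₁ W K N s + rK₂ W N hθ hθsq t = 0) (ht : t ∈ loc₂ W K N (pl ℓ₀)) :
    s ∈ loc₁ W N (pl ℓ₀) := by
  have hℓ₀ : ℓ₀.Prime := Fact.out
  have h2K : Module.finrank ℚ K = 2 := hK.1
  set v : HeightOneSpectrum (𝓞 ℚ) := primesEquiv.symm ⟨ℓ₀, hℓ₀⟩ with hvdef
  have hℓv : (ℓ₀ : 𝓞 ℚ) ∈ v.asIdeal := natCast_mem_primesEquiv_symm hℓ₀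
  rw [pl_of_prime hℓ₀] at ht ⊢
  change t ∈ selmerLocalKer (twin W K) (v.adicCompletion ℚ) (lvl N) at ht
  change s ∈ selmerLocalKer W (v.adicCompletion ℚ) (lvl N)
  -- bookkeeping at `v`
  have hgoodv : W.HasGoodReductionAt v := hasGoodReductionAt_of_hasGoodReductionAtPrime W hgood hℓv
  have hgoodv' : (twin W K).HasGoodReductionAt v :=
    hasGoodReductionAt_of_hasGoodReductionAtPrime (twin W K) hgood' hℓv
  have h2v : (2 : 𝓞 ℚ) ∉ v.asIdeal := ofNat_two_notMem_of_ne hℓ₀ hℓ₀2 hℓv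
  have hnv : ((lvl N : ℤ) : 𝓞 ℚ) ∉ v.asIdeal := by
    unfold lvl
    rw [Int.cast_natCast, Nat.cast_pow]
    exact fun h ↦ h2v (by exact_mod_cast v.isPrime.mem_of_pow_mem N h)
  have hdv : (((NumberField.discr K : ℤ) : ℤ) : 𝓞 ℚ) ∉ v.asIdeal := intCast_notMem_of_not_dvd hℓ₀ hℓv hℓ₀d
  have hθ' : θ ∉ (algebraMap ℚ K).range := not_mem_range hθ
  -- a place `w ∋ ℓ₀` of `K` and a prime `𝔔` above it
  obtain ⟨w, hℓw⟩ := exists_natCast_mem (K := K) hℓ₀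
  haveI : w.asIdeal.LiesOver v.asIdeal := liesOver_of_natCast_mem hℓ₀ hℓv hℓw
  obtain ⟨𝔔, h𝔔⟩ := w.primesAbove_nonempty
  have hgoodK : (W.baseChange K).HasGoodReductionAt w :=
    hasGoodReductionAt_baseChange_of_hasGoodReductionAt W K v w hgoodv
  have hnK : ((lvl N : ℤ) : 𝓞 K) ∉ w.asIdeal := intCast_notMem_of_liesOver K v w hnv
  have hfix : 𝔔.inertia (absoluteGaloisGroup K) ≤ torsionFixing (W.baseChange K) (lvl N) :=
    inertia_le_torsionFixing_of_hasGoodReductionAt (W.baseChange K) w hgoodK hnK h𝔔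
  -- `t` Selmer at `v`: `[hPsiKT (res t), τ] = 0` on `I_𝔔`
  have ht' := (mem_selmerLocalKer_twist_iff_forall_h1Eval_hPsiKT_eq_zero W h2K hθ' hθsq hθ hθsq (lvl N) v w
    hgoodv hgoodv' hnv h2v hdv h𝔔 t).mp ht
  -- hence `[res s, τ] = 0` on `I_𝔔`, i.e. `s` Selmer at `v`
  refine (mem_selmerLocalKer_iff_forall_h1Eval_resTorsion_eq_zero W h2K hθ' hθsq (lvl N) v w hgoodv hnv h2v
    hdv h𝔔 s).mpr fun τ hτ ↦ ?_
  have hρ := congrFun hrel ⟨τ, hfix hτ⟩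
  rw [Pi.add_apply, rK₁_apply, rK₂_apply, Pi.zero_apply, ht' τ hτ, add_zero] at hρ
  exact hρ

/-! ## §3 `hvis` from (H2) when the auxiliary class is ramified at `ℓ₀` -/

variable (M : ℕ)

/-- **The visibility input `hvis` of the deepening from (H2), ramified case**: `u ∈ H¹(ℚ, E[2])` Selmer off `ℓ₀`
but NOT Selmer at `ℓ₀` (`ℓ₀ ∤ 2 d_K` of good reduction), `y₀ ∈ Sel^{(2)}(E^{(d_K)}/ℚ)`. A relation
`rK₁ (a₁ ι u) + rK₂ (a₂ ι y₀) = 0` forces `a₁ ι u = ι (a₁ u)` to be Selmer at `ℓ₀` (`mem_loc₁_of_rK_add_eq_zero`),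
hence `a₁ u` Selmer at `ℓ₀` (`torsionH1OfDvd_mem_selmerLocalKer_iff`); as `2u = 0`, `a₁ u ∈ {0, u}`, so `a₁ u = 0`;
then `rK₂ (a₂ ι y₀) = 0` and (H2) (`Input.sel_visible` with `s₁ = 0`) gives `a₂ ι y₀ = 0`.
[cite: McCallumLMS1991, §5 proof of Prop. 5.2 ((7)–(8)), p. 299] [cite: GrossLMS1991, Prop. 9.1] -/
theorem hvis_of_sel_visible_of_not_mem (I : Input W K M hθ hθsq) (hK : IsImaginaryQuadratic K)
    [(twin W K).IsElliptic] (hM : 1 ≤ M) {ℓ₀ : ℕ} [Fact ℓ₀.Prime] (hℓ₀2 : ℓ₀ ≠ 2)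
    (hℓ₀d : ¬ ((ℓ₀ : ℤ) ∣ NumberField.discr K)) (hgood : W.HasGoodReductionAtPrime ℓ₀)
    (hgood' : (twin W K).HasGoodReductionAtPrime ℓ₀)
    {u : galH1Torsion W (lvl 1)} {y₀ : galH1Torsion (twin W K) (lvl 1)}
    (hunot : u ∉ loc₁ W 1 (pl ℓ₀)) (hy : y₀ ∈ selmerGroup (twin W K) (lvl 1)) :
    ∀ a₁' a₂' : ℤ, rK₁ W K M (a₁' • torsionH1OfDvd W (lvl_one_dvd_lvl hM) u) +
      rK₂ W M hθ hθsq (a₂' • torsionH1OfDvd (twin W K) (lvl_one_dvd_lvl hM) y₀) = 0 →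
      a₁' • torsionH1OfDvd W (lvl_one_dvd_lvl hM) u = 0 ∧
        a₂' • torsionH1OfDvd (twin W K) (lvl_one_dvd_lvl hM) y₀ = 0 := by
  intro a₁' a₂' hrel
  have hℓ₀ : ℓ₀.Prime := Fact.out
  set ι := torsionH1OfDvd W (lvl_one_dvd_lvl hM) with hιdef
  set ι' := torsionH1OfDvd (twin W K) (lvl_one_dvd_lvl hM) with hι'def
  -- `ι y₀` (hence `a₂ ι y₀`) is Selmer, in particular at `ℓ₀`
  have hιy : ι' y₀ ∈ selmerGroup (twin W K) (lvl M) := torsionH1OfDvd_mem_selmerGroup (twin W K) _ hy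
  have hιy₂ : a₂' • ι' y₀ ∈ selmerGroup (twin W K) (lvl M) := AddSubgroup.zsmul_mem _ hιy _
  have ht : a₂' • ι' y₀ ∈ loc₂ W K M (pl ℓ₀) := by
    rw [pl_of_prime hℓ₀]
    exact ((mem_selmerGroup_iff (twin W K) _ _).mp hιy₂).1 _
  -- so `a₁ ι u = ι (a₁ u)` is Selmer at `ℓ₀`, hence `a₁ u` is, hence `a₁ u = 0`
  have hs : a₁' • ι u ∈ loc₁ W M (pl ℓ₀) :=
    mem_loc₁_of_rK_add_eq_zero W K M hθ hθsq hK hℓ₀2 hℓ₀d hgood hgood' hrel ht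
  have hs' : a₁' • u ∈ loc₁ W 1 (pl ℓ₀) := by
    rw [pl_of_prime hℓ₀] at hs ⊢
    change a₁' • u ∈ selmerLocalKer W _ (lvl 1)
    rw [torsionH1OfDvd_mem_selmerLocalKer_iff W _ (lvl_one_dvd_lvl hM), map_zsmul]
    exact hs
  have h2u : (2 : ℤ) • u = 0 := by
    have h := zsmul_galH1Torsion_eq_zero W (lvl 1) u
    simpa [lvl] using h
  have ha₁ : a₁' • u = 0 := by
    -- `a₁ u = (a₁ mod 2) u ∈ {0, u}`; the value `u` is excluded by `hunot`
    rcases Int.even_or_odd a₁' with ⟨k, hk⟩ | ⟨k, hk⟩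
    · rw [hk, ← two_mul, mul_comm, ← smul_smul, h2u, zsmul_zero]
    · exfalso
      apply hunot
      have h1 : a₁' • u = u := by
        rw [hk, add_zsmul, one_zsmul, mul_comm, ← smul_smul, h2u, zsmul_zero, zero_add]
      rwa [h1] at hs'
  refine ⟨by rw [← map_zsmul, ha₁, map_zero], ?_⟩
  -- then `rK₂ (a₂ ι y₀) = 0`, and (H2) with `s₁ = 0`
  have hrel' : rK₁ W K M 0 + rK₂ W M hθ hθsq (a₂' • ι' y₀) = 0 := by
    have h0 : a₁' • ι u = 0 := by rw [← map_zsmul, ha₁, map_zero]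
    rwa [h0] at hrel
  exact (I.sel_visible 0 (AddSubgroup.zero_mem _) _ hιy₂ hrel').2

end Instance

end Summit.BirchSwinnertonDyer.BirchSwinnertonDyer.Theorems.GenusExact.VisiblePairAtTwo

end
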